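/-
Copyright (c) 2026 the pub-hodgecm-mathlib formalisation cell (harness21).  Prover seat hodgecm-mathlib-K2Liu-p11 (g0): Track B «K2-LIT»,
#184♮ = hLiu418 = stmt-HodgeConjecture-24832; Road I v3 support brick «WA» — the DISCHARGE of K2Liu-p10 (g0)'s by-value hypothesis `hWA` of ★
`K2LiuWeakApproximationDensity` (LEAD F0P6-plan (g12) «BRIDGE ONLY» K2/STATUS 2026-09-04T06:29:23Z; RULING «M-156d» (R-res)).
-/
import Summits.HodgeConjecture.HodgeCM.PerL34.AdelicUnitaryFactorisation          -- ★ `dense_cosets`: real approximation at `∞` for `U(H)` over a CM field, PROVED and transported to `U(H)(𝔸_{L⁺})`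
import Literature.NumberTheory.GelbartRogawski1991.DoubledWeilRepresentationDetTwist  -- ★ `det_hermD_ne_zero` (+ ★ `HA`, `ratH`, `hermD`, `gramD_isSymm`)
import Summits.HodgeConjecture.HodgeConjecture.Theorems.K2LiuWeakApproximationDensity     -- ★ K2Liu-p10 (g0) WA-0: (W1)(W2) BY VALUE on `hWA : DenseRange (rationalToArch …)`
import HarnessLib

/-!
# Crux `HLiu418`, road `K2_Liu`, Road I v3 brick «WA»: REAL WEAK APPROXIMATION FOR THE DOUBLED UNITARY GROUP, UNCONDITIONALLY —
# the discharge of ★ `K2LiuWeakApproximationDensity`'s `hWA` from the in-tree (HodgeCM) real approximation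

Cell `hodgecm-mathlib`, crux item hLiu418 = `stmt-HodgeConjecture-24832`, route of record `HCCMUnconditional`; squad K2 ∕ K2Liu, LEAD F0P6-plan (g12),
prover K2Liu-p11 (g0).  THEOREMS ONLY (no `def`, no instance, no notation, no named-fact hypothesis, no `sorry`); lane
`--supports stmt-HodgeConjecture-24832 --as helper` (count-neutral).  ★ `K2LiuWeakApproximationDensity` (K2Liu-p10 (g0)) types the CONSUMED forms (W1)∕(W2) BY VALUE on
`hWA : DenseRange (rationalToArch L⁺ L c (n+n) J^𝔻)`; this file DISCHARGES `hWA` (`denseRange_rationalToArch_hermD`) and records the unconditional (W1)∕(W2).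
Consumer: U2d `K2LiuWhiteheadVanishing` (the last step «`F = CT(F)` left-`H(L⁺)`-invariant, continuous, killed on the archimedean-trivial slice ⇒ `F = 0`»).

THE MATHEMATICS IS ★, NOT PRINT.  Real approximation at the archimedean places for the unitary group of a non-degenerate hermitian matrix over a CM field
([PlatonovRapinchuk1994, Thm. 7.7 ∕ Prop. 7.11]; [Kneser1966]) is PROVED in the tree by the joint Cayley-transform argument
(★ `HodgeCM.Literature.RealApproximationUnitary.RealApproximation_UH_holds`: `U(H)(L⁺)` is dense in `∏_{w∣∞} U(H_w)`, no connectedness input) and transported to the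
genuine adelic group by ★ `HodgeCM.PerL34.AdelicUnitaryFactorisation.dense_cosets`: for `ᵗH̄ = H`, `det H ≠ 0` and any family `ιA`, the set
`U(H)(L⁺) · ιA(·) · ιf(U(H)(𝔸_{L⁺,f}))` is dense in `U(H)(𝔸_{L⁺}) = ↥(adelicUnitaryGroup L H)`.  That carrier IS the doubled group's `HA L e dV hdV dW hdW`
(★ `adelicGroupData_eq_cmDatum` is `rfl`; ★ `adelic_complexConj` is carrier-`rfl`), so for `H := hermD` (the doubled form `J^𝔻`, hermitian by ★ `gramD_isSymm`,
non-degenerate by ★ `det_hermD_ne_zero`) this file is GLUE: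
* §1 bridge — `conjTranspose_map_hermD`, `isUnit_det_hermD`, `mem_ratH_of_mem_adelicUnitaryRat` (★ `mem_adelicUnitaryRat_iff`, ★ `rational_complexConj`),
  `archPart_ιf_eq_one` (★ `val_ιf`: `ιf k = (1, k)` has archimedean matrix `1`);
* §2 **(W1)** `dense_ratH_mul_archPart_eq_one` — `{γ·h : γ ∈ H(L⁺), h_∞ = 1}` is dense in `H(𝔸)`; **`denseRange_rationalToArch_hermD`** — `H(L⁺)` is dense in `H_∞`
  (= ★ WA-0's `hWA`, discharged: image of the dense set under the continuous surjection `archPart`); `exists_ratH_mul_mem_of_isOpen` — every non-empty open set of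
  `H(𝔸)` contains such a `γ·h` (★ WA-0 `dense_ratH_mul_ofFinite` at `hWA`);
* §3 **(W2)** `eq_zero_of_ratH_invariant_of_archPart_eq_one` — a continuous `F : H(𝔸) → ℂ` with `F(γ h) = F(h)` (`γ ∈ H(L⁺)`) and `F(h) = 0` whenever `h_∞ = 1`
  is identically `0` (★ WA-0 `eq_zero_of_ratH_invariant_of_vanish_ofFinite` at `hWA`); `eq_zero_of_ratH_invariant_of_level` — the same with the vanishing hypothesis
  on a level `h·K`.

References: [PlatonovRapinchuk1994, §7.1 Thm. 7.7, Prop. 7.11 (real approximation); §5.1]; [Kneser1966]; [BorelJacquet1979, §4.1].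
HONEST LABEL: HC_CM is proved only modulo the 7 printed citations (2 remaining named inputs: hLiu418 = stmt-HodgeConjecture-24832,
h413 = stmt-HodgeConjecture-24833) until rung 0 closes; count-neutral helper, closes no socket.
-/

set_option autoImplicit false
set_option linter.dupNamespace false

noncomputable section

open scoped Matrix
open Topology Set NumberField IsDedekindDomain
open Literature.NumberTheory.Automorphic Literature.NumberTheory.Automorphic.UnitaryGroup
open Literature.NumberTheory.GelbartRogawski1991 Literature.NumberTheory.GelbartRogawski1991.GRConstruction
open Literature.AlgebraicGeometry.ShimuraVarieties (unitaryGroup conjRingHomK)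
open HodgeCM.PerL34.AdelicUnitaryFactorisation

namespace Summit.HodgeConjecture.HodgeConjecture.Cruxes.HLiu418.K2LiuWeakApproximationOfHodgeCM

variable (L : Type) [Field L] [NumberField L] [IsCMField L]
variable {N M n : ℕ} (e : Fin N × Fin M ≃ Fin n)
  (dV : Fin N → L) (hdV : ∀ i, IsCMField.complexConj L (dV i) = dV i) (hdV0 : ∀ i, dV i ≠ 0)
  (dW : Fin M → L) (hdW : ∀ i, IsCMField.complexConj L (dW i) = dW i) (hdW0 : ∀ i, dW i ≠ 0)

/-! ## §1 The bridge to ★ `AdelicUnitaryFactorisation` -/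

/-- **`J^𝔻` is hermitian**: `ᵗ(c J^𝔻) = J^𝔻` (it is the base change of the symmetric `L⁺`-matrix ★ `gramD`, and `c` fixes `L⁺`). [cite: PlatonovRapinchuk1994, §2.3] -/
theorem conjTranspose_map_hermD :
    ((hermD L e dV hdV dW hdW).map (conjRingHomK (cm L)))ᵀ = hermD L e dV hdV dW hdW := by
  ext i j
  simp only [Matrix.transpose_apply, Matrix.map_apply, hermD]
  rw [(gramD_isSymm L e dV hdV dW hdW).apply i j]
  exact (IsCMField.complexConj L).commutes _

include hdV0 hdW0 in
/-- **`det J^𝔻` is a unit** (★ `det_hermD_ne_zero`). [cite: PlatonovRapinchuk1994, §2.3] -/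
theorem isUnit_det_hermD : IsUnit (hermD L e dV hdV dW hdW).det :=
  isUnit_iff_ne_zero.2 (DoubledWeilDetTwist.det_hermD_ne_zero L e dV hdV hdV0 dW hdW hdW0)

/-- the rational points of ★ `AdelicUnitaryFactorisation` (`adelicUnitaryRat`, diagonal images of ★ `unitaryGroup (cmConjRingHom L) J^𝔻`) are the doubled
group's ★ `ratH` (range of ★ `UnitaryGroup.toAdelic`; the two rational groups agree by ★ `rational_complexConj`, the two diagonal maps on matrices by `rfl`).
[cite: PlatonovRapinchuk1994, §5.1] -/
theorem mem_ratH_of_mem_adelicUnitaryRat {γ : HA L e dV hdV dW hdW} (hγ : γ ∈ adelicUnitaryRat L (hermD L e dV hdV dW hdW)) :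
    γ ∈ ratH L e dV hdV dW hdW := by
  obtain ⟨g, hg, hgγ⟩ := (mem_adelicUnitaryRat_iff L (hermD L e dV hdV dW hdW) γ).1 hγ
  have hg' : g ∈ rational (Fp L) L (IsCMField.complexConj L) (n + n) (hermD L e dV hdV dW hdW) := by
    rw [rational_complexConj]; exact hg
  exact ⟨⟨g, hg'⟩, Subtype.ext hgγ⟩

/-- **`(ιf k)_∞ = 1`**: the element `ιf k = (1, k)` of ★ `AdelicUnitaryFactorisation` (★ `val_ιf`) has trivial archimedean part. [cite: BorelJacquet1979, §4.1] -/
theorem archPart_ιf_eq_one (k : Ufin L (hermD L e dV hdV dW hdW)) :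
    UnitaryGroup.archPart (Fp L) L (IsCMField.complexConj L) (n + n) (hermD L e dV hdV dW hdW) (ιf L (hermD L e dV hdV dW hdW) k) = 1 := by
  have hfst : GLn.fstHom (n + n) L (adelicVal (Fp L) L (IsCMField.complexConj L) (n + n) (hermD L e dV hdV dW hdW) (ιf L (hermD L e dV hdV dW hdW) k)) = 1 :=
    Units.ext (Matrix.ext fun i j => congrArg Prod.fst (val_ιf L (hermD L e dV hdV dW hdW) k i j))
  refine Subtype.ext ?_
  rw [coe_archPart, GLn.toMixed_apply, hfst, map_one, OneMemClass.coe_one]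

/-! ## §2 (W1) `H(L⁺) · {h_∞ = 1}` is dense in `H(𝔸)` -/

include hdV0 hdW0 in
/-- **(W1) REAL WEAK APPROXIMATION FOR THE DOUBLED UNITARY GROUP**: the set `{γ · h : γ ∈ H(L⁺), h_∞ = 1}` is dense in `H(𝔸)` — ★ `dense_cosets` (real approximation
at `∞`, [PlatonovRapinchuk1994, Thm. 7.7], proved in-tree by the Cayley transform) at `H := J^𝔻`, `ιA := 1`. [cite: PlatonovRapinchuk1994, §7.1 Thm. 7.7, Prop. 7.11] [cite: Kneser1966] -/
theorem dense_ratH_mul_archPart_eq_one :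
    Dense {x : HA L e dV hdV dW hdW | ∃ γ ∈ ratH L e dV hdV dW hdW, ∃ h : HA L e dV hdV dW hdW,
      UnitaryGroup.archPart (Fp L) L (IsCMField.complexConj L) (n + n) (hermD L e dV hdV dW hdW) h = 1 ∧ x = γ * h} := by
  have hD := dense_cosets L (conjTranspose_map_hermD L e dV hdV dW hdW) (isUnit_det_hermD L e dV hdV hdV0 dW hdW hdW0)
    (fun _ : Unit => (1 : adelicUnitaryGroup L (hermD L e dV hdV dW hdW))) ()
  refine hD.mono ?_
  rintro x ⟨γ, hγ, _, k, rfl⟩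
  exact ⟨γ, mem_ratH_of_mem_adelicUnitaryRat L e dV hdV dW hdW hγ, ιf L (hermD L e dV hdV dW hdW) k, archPart_ιf_eq_one L e dV hdV dW hdW k,
    congrArg (fun y => y * ιf L (hermD L e dV hdV dW hdW) k) (mul_one γ)⟩

include hdV0 hdW0 in
/-- **REAL WEAK APPROXIMATION AT `∞` FOR `H = U(J^𝔻)`**: `H(L⁺)` is dense in `H_∞ = H(L⁺ ⊗ ℝ)` — the by-value hypothesis `hWA` of ★ `K2LiuWeakApproximationDensity`
DISCHARGED (image of the dense set of `dense_ratH_mul_archPart_eq_one` under the continuous surjection ★ `archPart`; ★ `archPart_toAdelic'`).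
[cite: PlatonovRapinchuk1994, §7.1 Thm. 7.7] [cite: Kneser1966] -/
theorem denseRange_rationalToArch_hermD :
    DenseRange (rationalToArch (Fp L) L (IsCMField.complexConj L) (n + n) (hermD L e dV hdV dW hdW)) := by
  have himg := (UnitaryGroup.archPart_surjective (Fp L) L (IsCMField.complexConj L) (n + n) (hermD L e dV hdV dW hdW)).denseRange.dense_image
    (UnitaryGroup.continuous_archPart (Fp L) L (IsCMField.complexConj L) (n + n) (hermD L e dV hdV dW hdW))
    (dense_ratH_mul_archPart_eq_one L e dV hdV hdV0 dW hdW hdW0)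
  refine Dense.mono ?_ himg
  rintro _ ⟨x, ⟨γ, ⟨g, rfl⟩, h, hh, rfl⟩, rfl⟩
  refine ⟨g, ?_⟩
  -- `archPart` is multiplicative on `↥HA`-typed products (the datum's `Adelic` and `↥HA` agree only up to unfolding, so `map_mul` is instantiated by `have`)
  have hm : UnitaryGroup.archPart (Fp L) L (IsCMField.complexConj L) (n + n) (hermD L e dV hdV dW hdW)
      (UnitaryGroup.toAdelic (Fp L) L (IsCMField.complexConj L) (n + n) (hermD L e dV hdV dW hdW) g * h) =
      UnitaryGroup.archPart (Fp L) L (IsCMField.complexConj L) (n + n) (hermD L e dV hdV dW hdW)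
        (UnitaryGroup.toAdelic (Fp L) L (IsCMField.complexConj L) (n + n) (hermD L e dV hdV dW hdW) g) *
      UnitaryGroup.archPart (Fp L) L (IsCMField.complexConj L) (n + n) (hermD L e dV hdV dW hdW) h := map_mul _ _ _
  rw [hm, hh, mul_one]
  exact (archPart_toAdelic' (Fp L) L (IsCMField.complexConj L) (n + n) (hermD L e dV hdV dW hdW) g).symm

include hdV0 hdW0 in
/-- **(W1), open-set form** (★ WA-0 `dense_ratH_mul_ofFinite` at the discharged `hWA`): every non-empty open subset of `H(𝔸)` contains `γ · h` with `γ ∈ H(L⁺)`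
and `h_∞ = 1`. [cite: PlatonovRapinchuk1994, §7.1 Thm. 7.7, Prop. 7.11] [cite: Kneser1966] -/
theorem exists_ratH_mul_mem_of_isOpen (U : Set (HA L e dV hdV dW hdW)) (hU : IsOpen U) (hne : U.Nonempty) :
    ∃ γ ∈ ratH L e dV hdV dW hdW, ∃ h : HA L e dV hdV dW hdW,
      UnitaryGroup.archPart (Fp L) L (IsCMField.complexConj L) (n + n) (hermD L e dV hdV dW hdW) h = 1 ∧ γ * h ∈ U :=
  K2LiuWeakApproximationDensity.dense_ratH_mul_ofFinite L e dV hdV dW hdW (denseRange_rationalToArch_hermD L e dV hdV hdV0 dW hdW hdW0) hU hne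

/-! ## §3 (W2) Left-`H(L⁺)`-invariant continuous functions vanishing on `{h_∞ = 1}` vanish -/

include hdV0 hdW0 in
/-- **(W2)** (★ WA-0 `eq_zero_of_ratH_invariant_of_vanish_ofFinite` at the discharged `hWA`): a continuous `F : H(𝔸) → ℂ` with `F(γ h) = F(h)` for all `γ ∈ H(L⁺)`
and `F(h) = 0` whenever `h_∞ = 1` is identically zero. [cite: PlatonovRapinchuk1994, §7.1 Thm. 7.7, Prop. 7.11] [cite: Kneser1966] -/
theorem eq_zero_of_ratH_invariant_of_archPart_eq_one (F : HA L e dV hdV dW hdW → ℂ) (hF : Continuous F)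
    (hγ : ∀ γ ∈ ratH L e dV hdV dW hdW, ∀ h : HA L e dV hdV dW hdW, F (γ * h) = F h)
    (h0 : ∀ h : HA L e dV hdV dW hdW, UnitaryGroup.archPart (Fp L) L (IsCMField.complexConj L) (n + n) (hermD L e dV hdV dW hdW) h = 1 → F h = 0) : F = 0 :=
  K2LiuWeakApproximationDensity.eq_zero_of_ratH_invariant_of_vanish_ofFinite L e dV hdV dW hdW (denseRange_rationalToArch_hermD L e dV hdV hdV0 dW hdW hdW0)
    F hF hγ h0

include hdV0 hdW0 in
/-- **(W2), level form**: if `F(h k) = 0` for all `h` with `h_∞ = 1` and all `k` in some subgroup `K` (e.g. the standard compact open level), then `F = 0`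
(take `k = 1`). [cite: PlatonovRapinchuk1994, §7.1 Thm. 7.7, Prop. 7.11] -/
theorem eq_zero_of_ratH_invariant_of_level (F : HA L e dV hdV dW hdW → ℂ) (hF : Continuous F)
    (hγ : ∀ γ ∈ ratH L e dV hdV dW hdW, ∀ h : HA L e dV hdV dW hdW, F (γ * h) = F h) (K : Subgroup (HA L e dV hdV dW hdW))
    (h0 : ∀ h : HA L e dV hdV dW hdW, UnitaryGroup.archPart (Fp L) L (IsCMField.complexConj L) (n + n) (hermD L e dV hdV dW hdW) h = 1 → ∀ k ∈ K, F (h * k) = 0) : F = 0 :=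
  eq_zero_of_ratH_invariant_of_archPart_eq_one L e dV hdV hdV0 dW hdW hdW0 F hF hγ fun h hh => by
    have h1 := h0 h hh 1 K.one_mem
    rwa [mul_one] at h1

end Summit.HodgeConjecture.HodgeConjecture.Cruxes.HLiu418.K2LiuWeakApproximationOfHodgeCM

end
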